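import Literature.InformationTheory.QuantumCodes.ClusterCountingBound
import Mathlib.Analysis.SpecialFunctions.Pow.Real
import Mathlib.Algebra.Order.Field.GeomSum
import HarnessLib

/-!
# Independent noise along a fixed path: the half-weight bound `(4 p (1-p))^{H/2}` and the
# Peierls / path-counting union bound (Dennis–Kitaev–Landahl–Preskill 2002, §5.2)

Topic `Literature/InformationTheory/QuantumCodes` (venture QEC, LADDER-QEC rung Q5). Theorem-only
companion of `ClusterCountingBound.lean` (whose `bernoulliWeight p E = p^|E| (1-p)^(|V|-|E|)` is the
i.i.d. error model of DKLP §4.1): the PROBABILISTIC half of the toric-code counting bound, in the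
refined i.i.d. form with `p̃ = p(1-p)` in place of `p`.

* (private) `sum_eq_sum_powerset_sum_powerset_compl` — the error set `E` is split as
  `E = (E ∩ T) ∪ (E ∖ T)`: `Σ_E g E = Σ_{A ⊆ T} Σ_{F ⊆ Tᶜ} g (A ∪ F)`;
* `bernoulliWeight_union` — for `A ⊆ T`, `F ⊆ Tᶜ`: `w_p(A ∪ F) = p^|A| (1-p)^(|T|-|A|) · p^|F| (1-p)^(|Tᶜ|-|F|)`;
* `sum_powerset_compl_bernoulliWeight_union`, `sum_bernoulliWeight_filter_inter` —
  `ℙ(E ∩ T = A) = p^|A| (1-p)^(|T|-|A|)` (the errors off `T` integrate out by the binomial theorem),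
  hence `Σ_{E : P (T ∩ E)} w_p(E) = Σ_{A ⊆ T, P A} p^|A| (1-p)^(|T|-|A|)`;
* `pow_mul_pow_le_sqrt_pow` — for `0 ≤ p ≤ 1/2` and `2a ≥ t`: `p^a (1-p)^(t-a) ≤ (√(p(1-p)))^t`
  ("with `p < 1/2`", DKLP before eq. (27));
* **`sum_bernoulliWeight_halfDense_le`** — DKLP eq. (27) ("the probability that a particular
  connected path with `H` horizontal links is contained in `E + E_min` is bounded above by
  `(4 p̃)^{H/2}`"): for a fixed set `T` of `H` links,
  `ℙ(at least half of the links of T carry errors) ≤ (2 √(p(1-p)))^H = (4 p̃)^{H/2}`;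
* **`sum_bernoulliWeight_le_of_cover`** — the union bound behind DKLP eq. (28): if every error
  set in `Bad` has at least half of the links of SOME member `T i`, `i ∈ Ps`, of a finite family,
  then `Σ_{E ∈ Bad} w_p(E) ≤ Σ_{i ∈ Ps} (2 √(p(1-p)))^{|T i|}`;
* `geom_tail_le` — the geometric tail `Σ_{H=L}^{N-1} r^H ≤ r^L/(1-r)`.

The CODING half (which paths: homologically non-trivial self-avoiding polygons of the toric
lattice, `H ≥ L`, at least half of their links in `E` by minimality of `E_min`) and the counting of
those polygons are in the toric-code files; this file is lattice-free.

## References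

* [DennisEtAl2002] E. Dennis, A. Kitaev, A. Landahl, J. Preskill, *Topological quantum memory*,
  J. Math. Phys. 43 (2002) 4452–4505, arXiv:quant-ph/0110143, §5.2 eqs. (26)–(28) (the per-path
  bound with `p̃ = p(1-p)` and the sum over self-avoiding polygons).
-/

open Finset

namespace Literature.InformationTheory.QuantumCodes

variable {V : Type*} [Fintype V] [DecidableEq V]

/-! ### Splitting an error set along a fixed set of links -/

omit [Fintype V] in
/-- Splitting the sum over all error sets `E` according to `E ∩ T` and `E ∖ T`:
`Σ_{E ⊆ S} g E = Σ_{A ⊆ T} Σ_{F ⊆ S ∖ T} g (A ∪ F)` for `T ⊆ S`. [folklore] -/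
private theorem sum_powerset_eq_sum_powerset_sum_powerset_sdiff {M : Type*} [AddCommMonoid M]
    (S T : Finset V) (hTS : T ⊆ S) (g : Finset V → M) :
    ∑ E ∈ S.powerset, g E = ∑ A ∈ T.powerset, ∑ F ∈ (S \ T).powerset, g (A ∪ F) := by
  rw [← Finset.sum_product (T.powerset) ((S \ T).powerset) (fun x => g (x.1 ∪ x.2))]
  refine Finset.sum_nbij' (fun E => (E ∩ T, E \ T)) (fun x => x.1 ∪ x.2) ?_ ?_ ?_ ?_ ?_
  · intro E hE
    rw [Finset.mem_powerset] at hE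
    rw [Finset.mem_product, Finset.mem_powerset, Finset.mem_powerset]
    exact ⟨Finset.inter_subset_right, Finset.sdiff_subset_sdiff hE le_rfl⟩
  · intro x hx
    rw [Finset.mem_product, Finset.mem_powerset, Finset.mem_powerset] at hx
    rw [Finset.mem_powerset]
    exact Finset.union_subset (hx.1.trans hTS) (hx.2.trans Finset.sdiff_subset)
  · intro E _
    ext v
    simp only [Finset.mem_union, Finset.mem_inter, Finset.mem_sdiff]
    tauto
  · intro x hx
    rw [Finset.mem_product, Finset.mem_powerset, Finset.mem_powerset] at hx
    obtain ⟨hA, hF⟩ := hx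
    have hdisj : Disjoint x.2 T := by
      rw [Finset.disjoint_left]
      intro v hv hvT
      exact (Finset.mem_sdiff.1 (hF hv)).2 hvT
    ext1
    · simp only
      rw [Finset.union_inter_distrib_right, Finset.inter_eq_left.2 hA,
        Finset.disjoint_iff_inter_eq_empty.1 hdisj, Finset.union_empty]
    · simp only
      rw [Finset.union_sdiff_distrib, Finset.sdiff_eq_empty_iff_subset.2 hA, Finset.empty_union,
        Finset.sdiff_eq_self_iff_disjoint.2 hdisj]
  · intro E _
    simp only
    congr 1
    ext v
    simp only [Finset.mem_union, Finset.mem_inter, Finset.mem_sdiff]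
    tauto

/-- Splitting the sum over ALL error sets `E ⊆ V` according to `E ∩ T` and `E ∖ T`:
`Σ_E g E = Σ_{A ⊆ T} Σ_{F ⊆ Tᶜ} g (A ∪ F)`. [folklore] -/
private theorem sum_eq_sum_powerset_sum_powerset_compl {M : Type*} [AddCommMonoid M]
    (T : Finset V) (g : Finset V → M) :
    ∑ E, g E = ∑ A ∈ T.powerset, ∑ F ∈ (Tᶜ).powerset, g (A ∪ F) := by
  rw [← Finset.powerset_univ, Finset.compl_eq_univ_sdiff]
  exact sum_powerset_eq_sum_powerset_sum_powerset_sdiff univ T (Finset.subset_univ T) g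

/-- The i.i.d. weight factorises along `T`: for `A ⊆ T` and `F ⊆ Tᶜ`,
`w_p(A ∪ F) = p^|A| (1-p)^(|T|-|A|) · (p^|F| (1-p)^(|Tᶜ|-|F|))` (independence of the links inside
and outside `T`). [cite: DennisEtAl2002, §4.1 (errors independent on different qubits)] -/
theorem bernoulliWeight_union (p : ℝ) {T A F : Finset V} (hA : A ⊆ T) (hF : F ⊆ Tᶜ) :
    bernoulliWeight p (A ∪ F) =
      p ^ A.card * (1 - p) ^ (T.card - A.card) * (p ^ F.card * (1 - p) ^ ((Tᶜ).card - F.card)) := by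
  have hdisj : Disjoint A F := by
    rw [Finset.disjoint_left]
    intro v hvA hvF
    exact (Finset.mem_compl.1 (hF hvF)) (hA hvA)
  have hAc : A.card ≤ T.card := Finset.card_le_card hA
  have hFc : F.card ≤ (Tᶜ).card := Finset.card_le_card hF
  have hTc : (Tᶜ).card = Fintype.card V - T.card := Finset.card_compl T
  have hTle : T.card ≤ Fintype.card V := Finset.card_le_univ T
  unfold bernoulliWeight
  rw [Finset.card_union_of_disjoint hdisj, pow_add]
  have : Fintype.card V - (A.card + F.card) = (T.card - A.card) + ((Tᶜ).card - F.card) := by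
    rw [hTc]; omega
  rw [this, pow_add]
  ring

/-- **The errors off `T` integrate out**: for `A ⊆ T`,
`Σ_{F ⊆ Tᶜ} w_p(A ∪ F) = p^|A| (1-p)^(|T|-|A|)`, i.e. `ℙ(E ∩ T = A) = p^|A| (1-p)^(|T|-|A|)`
(binomial theorem on `Tᶜ`). [cite: DennisEtAl2002, §4.1 (independent errors with probability p per qubit)] -/
theorem sum_powerset_compl_bernoulliWeight_union (p : ℝ) {T A : Finset V} (hA : A ⊆ T) :
    ∑ F ∈ (Tᶜ).powerset, bernoulliWeight p (A ∪ F) = p ^ A.card * (1 - p) ^ (T.card - A.card) := by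
  have hrew : ∀ F ∈ (Tᶜ).powerset, bernoulliWeight p (A ∪ F) =
      p ^ A.card * (1 - p) ^ (T.card - A.card) * (p ^ F.card * (1 - p) ^ ((Tᶜ).card - F.card)) :=
    fun F hF => bernoulliWeight_union p hA (Finset.mem_powerset.1 hF)
  rw [Finset.sum_congr rfl hrew, ← Finset.mul_sum, Finset.sum_pow_mul_eq_add_pow,
    show p + (1 - p) = 1 by ring, one_pow, mul_one]

/-- The sum of the i.i.d. weights over the error sets `E` whose trace on `T` satisfies a property
`P` is the sum over `A ⊆ T` with `P A` of `p^|A| (1-p)^(|T|-|A|)`.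
[cite: DennisEtAl2002, §5.2 (probability that given links have errors)] -/
theorem sum_bernoulliWeight_filter_inter (p : ℝ) (T : Finset V) (P : Finset V → Prop)
    [DecidablePred P] :
    ∑ E ∈ univ.filter (fun E => P (T ∩ E)), bernoulliWeight p E =
      ∑ A ∈ T.powerset.filter P, p ^ A.card * (1 - p) ^ (T.card - A.card) := by
  classical
  rw [Finset.sum_filter, sum_eq_sum_powerset_sum_powerset_compl T, Finset.sum_filter]
  refine Finset.sum_congr rfl fun A hA => ?_
  have hA' : A ⊆ T := Finset.mem_powerset.1 hA
  have hint : ∀ F ∈ (Tᶜ).powerset, T ∩ (A ∪ F) = A := by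
    intro F hF
    have hF' : F ⊆ Tᶜ := Finset.mem_powerset.1 hF
    rw [Finset.inter_union_distrib_left, Finset.inter_eq_right.2 hA']
    have : T ∩ F = ∅ := by
      rw [← Finset.disjoint_iff_inter_eq_empty, Finset.disjoint_left]
      intro v hvT hvF
      exact (Finset.mem_compl.1 (hF' hvF)) hvT
    rw [this, Finset.union_empty]
  have hcongr : ∀ F ∈ (Tᶜ).powerset,
      (if P (T ∩ (A ∪ F)) then bernoulliWeight p (A ∪ F) else 0) =
        if P A then bernoulliWeight p (A ∪ F) else 0 := by
    intro F hF
    rw [hint F hF]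
  rw [Finset.sum_congr rfl hcongr]
  split_ifs with h
  · exact sum_powerset_compl_bernoulliWeight_union p hA'
  · simp

/-! ### At least half of the links of `T` carry errors -/

/-- For `0 ≤ p ≤ 1/2` and `2a ≥ t` (`a ≤ t`): `p^a (1-p)^(t-a) ≤ (√(p(1-p)))^t` — each term of the
binomial sum with at least half of the links in error is at most `p̃^{t/2}`, `p̃ = p(1-p)`
("with `p < 1/2`"). [cite: DennisEtAl2002, §5.2 eqs. (26)–(27)] -/
theorem pow_mul_pow_le_sqrt_pow {p : ℝ} (hp0 : 0 ≤ p) (hp : p ≤ 1 / 2) {t a : ℕ} (hat : a ≤ t)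
    (h2a : t ≤ 2 * a) : p ^ a * (1 - p) ^ (t - a) ≤ (Real.sqrt (p * (1 - p))) ^ t := by
  have hq0 : 0 ≤ 1 - p := by linarith
  have hpq : 0 ≤ p * (1 - p) := mul_nonneg hp0 hq0
  set s := Real.sqrt (p * (1 - p)) with hs
  have hs0 : 0 ≤ s := Real.sqrt_nonneg _
  have hss : s * s = p * (1 - p) := Real.mul_self_sqrt hpq
  -- `p ≤ √(p(1-p))` since `p² ≤ p(1-p)` for `p ≤ 1/2`
  have hps : p ≤ s := by
    rw [hs]
    refine Real.le_sqrt_of_sq_le ?_  -- hmm: name check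
    nlinarith
  -- write `a = m + b`, `t = 2m + b` with `m = t - a`, `b = 2a - t`
  obtain ⟨m, hm⟩ : ∃ m, m = t - a := ⟨_, rfl⟩
  obtain ⟨b, hb⟩ : ∃ b, a = m + b := ⟨a - m, by omega⟩
  have ht : t = 2 * m + b := by omega
  calc p ^ a * (1 - p) ^ (t - a)
      = (p * (1 - p)) ^ m * p ^ b := by
        have : t - a = m := hm.symm
        rw [this, hb, pow_add, mul_pow]
        ring
    _ ≤ (p * (1 - p)) ^ m * s ^ b := by
        exact mul_le_mul_of_nonneg_left (pow_le_pow_left₀ hp0 hps b) (pow_nonneg hpq _)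
    _ = s ^ t := by
        rw [ht, pow_add, pow_mul, ← hss]
        ring

/-- **DKLP eq. (27), i.i.d. form.** For a fixed set `T` of `H = |T|` links and independent
errors of rate `0 ≤ p ≤ 1/2`, the probability that at least half of the links of `T` carry
errors is at most `(2 √(p(1-p)))^H = (4 p̃)^{H/2}`, `p̃ = p(1-p)`: there are at most `2^H` ways
to place the errors on `T`, each of probability `≤ p̃^{H/2}` ("the probability that a particular
connected path with `H` horizontal links is contained in `E + E_min` is bounded above by
`(4 p̃)^{H/2}`"). [cite: DennisEtAl2002, §5.2 eq. (27)] -/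
theorem sum_bernoulliWeight_halfDense_le {p : ℝ} (hp0 : 0 ≤ p) (hp : p ≤ 1 / 2)
    (T : Finset V) :
    ∑ E ∈ univ.filter (fun E => T.card ≤ 2 * (T ∩ E).card), bernoulliWeight p E ≤
      (2 * Real.sqrt (p * (1 - p))) ^ T.card := by
  classical
  rw [sum_bernoulliWeight_filter_inter p T (fun A => T.card ≤ 2 * A.card)]
  calc ∑ A ∈ T.powerset.filter (fun A => T.card ≤ 2 * A.card), p ^ A.card * (1 - p) ^ (T.card - A.card)
      ≤ ∑ A ∈ T.powerset.filter (fun A => T.card ≤ 2 * A.card), (Real.sqrt (p * (1 - p))) ^ T.card := by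
        refine Finset.sum_le_sum fun A hA => ?_
        rw [Finset.mem_filter, Finset.mem_powerset] at hA
        exact pow_mul_pow_le_sqrt_pow hp0 hp (Finset.card_le_card hA.1) hA.2
    _ ≤ ∑ A ∈ T.powerset, (Real.sqrt (p * (1 - p))) ^ T.card :=
        Finset.sum_le_sum_of_subset_of_nonneg (Finset.filter_subset _ _)
          (fun _ _ _ => pow_nonneg (Real.sqrt_nonneg _) _)
    _ = (2 * Real.sqrt (p * (1 - p))) ^ T.card := by
        rw [Finset.sum_const, Finset.card_powerset, nsmul_eq_mul, mul_pow]
        push_cast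
        ring

/-! ### The union bound over a family of paths -/

/-- **The Peierls / path-counting union bound** (the step from eq. (27) to eq. (28) of DKLP):
if every error set `E ∈ Bad` carries errors on at least half of the links of some member `T i`,
`i ∈ Ps`, of a finite family of link sets, then under independent errors of rate `0 ≤ p ≤ 1/2`
`Σ_{E ∈ Bad} w_p(E) ≤ Σ_{i ∈ Ps} (2 √(p(1-p)))^{|T i|}`.
[cite: DennisEtAl2002, §5.2 eq. (28)] -/
theorem sum_bernoulliWeight_le_of_cover {ι : Type*} {p : ℝ} (hp0 : 0 ≤ p) (hp : p ≤ 1 / 2)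
    (Ps : Finset ι) (T : ι → Finset V) (Bad : Finset (Finset V))
    (hcover : ∀ E ∈ Bad, ∃ i ∈ Ps, (T i).card ≤ 2 * (T i ∩ E).card) :
    ∑ E ∈ Bad, bernoulliWeight p E ≤ ∑ i ∈ Ps, (2 * Real.sqrt (p * (1 - p))) ^ (T i).card := by
  classical
  have hp1 : p ≤ 1 := by linarith
  have hnn : ∀ E : Finset V, 0 ≤ bernoulliWeight p E := bernoulliWeight_nonneg hp0 hp1
  calc ∑ E ∈ Bad, bernoulliWeight p E
      ≤ ∑ E ∈ Bad, ∑ i ∈ Ps,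
          (if (T i).card ≤ 2 * (T i ∩ E).card then bernoulliWeight p E else 0) := by
        refine Finset.sum_le_sum fun E hE => ?_
        obtain ⟨i, hi, hiE⟩ := hcover E hE
        calc bernoulliWeight p E
            = (if (T i).card ≤ 2 * (T i ∩ E).card then bernoulliWeight p E else 0) := by
              rw [if_pos hiE]
          _ ≤ ∑ i ∈ Ps, (if (T i).card ≤ 2 * (T i ∩ E).card then bernoulliWeight p E else 0) :=
              Finset.single_le_sum (f := fun i =>
                  if (T i).card ≤ 2 * (T i ∩ E).card then bernoulliWeight p E else 0)
                (fun j _ => by split_ifs <;> simp [hnn E]) hi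
    _ = ∑ i ∈ Ps, ∑ E ∈ Bad,
          (if (T i).card ≤ 2 * (T i ∩ E).card then bernoulliWeight p E else 0) :=
        Finset.sum_comm
    _ ≤ ∑ i ∈ Ps, ∑ E, (if (T i).card ≤ 2 * (T i ∩ E).card then bernoulliWeight p E else 0) := by
        refine Finset.sum_le_sum fun i _ => ?_
        exact Finset.sum_le_sum_of_subset_of_nonneg (Finset.subset_univ _)
          (fun E _ _ => by split_ifs <;> simp [hnn E])
    _ = ∑ i ∈ Ps, ∑ E ∈ univ.filter (fun E => (T i).card ≤ 2 * (T i ∩ E).card),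
          bernoulliWeight p E := by
        refine Finset.sum_congr rfl fun i _ => ?_
        rw [Finset.sum_filter]
    _ ≤ ∑ i ∈ Ps, (2 * Real.sqrt (p * (1 - p))) ^ (T i).card :=
        Finset.sum_le_sum fun i _ => sum_bernoulliWeight_halfDense_le hp0 hp (T i)

/-- The geometric tail used with the union bound: for `0 ≤ r < 1`,
`Σ_{H = L}^{N-1} r^H ≤ r^L / (1 - r)` (Mathlib's `geom_sum_Ico_le_of_lt_one`, recorded in the
form consumed by the toric-code bound: "rapidly approaches zero as `L` gets large").
[cite: DennisEtAl2002, §5.3 eq. (fail_2d)] -/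
theorem geom_tail_le {r : ℝ} (hr0 : 0 ≤ r) (hr1 : r < 1) (L N : ℕ) :
    ∑ H ∈ Finset.Ico L N, r ^ H ≤ r ^ L / (1 - r) :=
  geom_sum_Ico_le_of_lt_one hr0 hr1

end Literature.InformationTheory.QuantumCodes
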